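import Summits.Parity.GeneralizedHardyLittlewood.Theorems.GoldbachHeathBrownDispersionHeathBrownMorozUniformClassComparison
import Summits.Parity.GeneralizedHardyLittlewood.Theorems.GoldbachHeathBrownDispersionHeathBrownMorozUniformReduction
import Summits.Parity.GeneralizedHardyLittlewood.Theorems.GoldbachHeathBrownDispersionHeathBrownMorozUniformFrameShift
import Literature.NumberTheory.Sieve.HeathBrownMorozClassApproxAssembly
import HarnessLib

/-!
# Crux `HeathBrownMorozUniform` (stmt-Parity-19915) from the three class lemmas (FL, leading parts, Type II)

Final helper (`--supports stmt-Parity-19915`) of the skeleton of the coset port: the crux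
`Summit.Parity.GeneralizedHardyLittlewood.Theses.GoldbachHeathBrownDispersion.HeathBrownMorozUniform` follows
from the class versions, for every reduced admissible class `(a, b) mod d`, of
[HeathBrownActa2001] Lemma 3.5 (`h35`; HBM04 Lemma 3.1), Lemma 3.9 (`h39`; HBM04 Lemma 4.1) and Lemma 3.10 with
(3.14) up to `d·Q₁` (`h310`; HBM04 Prop. 4.2 (ii)) — the three STUBS of the campaign — everything else being
PROVED in the tree: the class Lemma 3.4 / 3.6 / 3.7 (`HeathBrownMoroz2004_lemma_3_4/3_2/3_3`), the class
bookkeeping in η-band form (`classTypeII_terms_band`, `classSieveComparison_band`, `classAsymptotic_band`), the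
frame shift (`…FrameShift`), the frame transfer of this file, and the finite max (`heathBrownMorozUniform_of_allLargeC`).  Contents:

* `classAsymp_allLargeC_of_band` — **frame transfer**: the band asymptotic at height `X = dX'` with
  `η = (log X')^{-c} ∈ [(log X)^{-c}, 2^c(log X)^{-c}]` gives the crux's class asymptotic for every `c ≥ c₀`
  (`log(dX')/log X' → 1`, `(log log(dX'))^{-1/6} → 0`, shift `= o(main term)`);
* **`heathBrownMorozUniform_of_classLemmas`** — the crux from `h35`, `h39`, `h310`.

References: [cite: HeathBrownMoroz2004, Theorem 2 and §5]; [cite: HeathBrownActa2001, Theorem 1].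
Tree: `residueClassPrimePairs`, `mem_residueClassPrimePairs_iff`, `classPairs`, `mem_classPairs_iff`,
`mem_boxPairs_iff`, `classPrimeCount_def`, `mainTerm`, `mainTerm_pos`, `mainTerm_mul_loglog_isLittleO`,
`isLittleO_linear_mainTerm`, `heathBrownMorozUniform_of_allLargeC`, `HeathBrownMoroz2004_lemma_3_3`,
`classPairs_subset_boxPairs`.
-/

noncomputable section

open Polynomial NumberField Finset Filter Topology Asymptotics

namespace Summit.Parity.GeneralizedHardyLittlewood.Theorems.GoldbachHeathBrownDispersionHeathBrownMorozUniform

open Literature.NumberTheory.Sieve.CubicSieve Literature.NumberTheory.Sieve.CubicPrimes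
open Literature.NumberTheory.LFunctions.CubeRootTwoField

/-! ### Frame transfer: from the band asymptotic at height `dX'` to the crux's class asymptotic -/

/-- **Frame transfer.** If the class count of Heath-Brown's frame satisfies the band asymptotic
`|π(𝒜_cl)(X, η) − (w(d)/d²)σ₀η²X²/(3 log X)| ≤ C η²X²(log X)^{-1}(log log X)^{-1/6}` for every `c ≥ c₀`,
`K_b ≥ 1`, `X ≥ X₀` and `η ∈ [(log X)^{-c}, K_b(log X)^{-c}]` (output of `classAsymptotic_band`), then for every
`c ≥ c₀` the crux's class asymptotic holds: `residueClassPrimeCount X' (log X')^{-c} d a b − w(d)·mainTerm c σ₀ X'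
= o(mainTerm c σ₀ X')` — evaluate at `X = dX'`, `η = (log X')^{-c}` (in the band with `K_b = 2^c` once
`X' ≥ d`), use the real box-shift lemma, `log(dX')/log X' → 1` and `(log log X')^{-1/6} → 0`.
[cite: HeathBrownMoroz2004, Theorem 2] -/
theorem classAsymp_allLargeC_of_band {d a b : ℕ} (hd : 1 ≤ d)
    (hband : ∃ c₀ : ℝ, 0 < c₀ ∧ ∃ σ₀ : ℝ, 0 < σ₀ ∧ Tendsto singularProductPartial atTop (𝓝 σ₀) ∧
      ∀ c : ℝ, c₀ ≤ c → ∀ Kb : ℝ, 1 ≤ Kb → ∃ C X₀ : ℝ, ∀ X η : ℝ, X₀ ≤ X →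
        Real.log X ^ (-c) ≤ η → η ≤ Kb * Real.log X ^ (-c) →
        |(classPrimeCount X η d a b : ℝ) -
            classWeight d / (d : ℝ) ^ 2 * (σ₀ * η ^ 2 * X ^ 2 / (3 * Real.log X))| ≤
          C * (η ^ 2 * X ^ 2 / Real.log X * Real.log (Real.log X) ^ (-(1 / 6 : ℝ)))) :
    ∃ c₁ : ℝ, 0 < c₁ ∧ ∀ c : ℝ, c₁ ≤ c →
      ∃ σ₀ : ℝ, 0 < σ₀ ∧ Tendsto singularProductPartial atTop (𝓝 σ₀) ∧
        ((fun X : ℝ => (residueClassPrimeCount X (Real.log X ^ (-c)) d a b : ℝ) -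
            classWeight d * mainTerm c σ₀ X) =o[atTop] fun X : ℝ => mainTerm c σ₀ X) := by
  obtain ⟨c₀, hc₀, σ₀, hσ₀, hlim, H⟩ := hband
  refine ⟨c₀, hc₀, fun c hc => ⟨σ₀, hσ₀, hlim, ?_⟩⟩
  have hcpos : 0 < c := hc₀.trans_le hc
  set Kb : ℝ := (2 : ℝ) ^ c with hKb
  have hKb1 : 1 ≤ Kb := Real.one_le_rpow (by norm_num) hcpos.le
  obtain ⟨C, X₀, hC⟩ := H c hc Kb hKb1
  set w := classWeight d with hw
  have hwpos : 0 < w := classWeight_pos d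
  have hd0 : (0 : ℝ) < d := by exact_mod_cast hd
  have hd1 : (1 : ℝ) ≤ d := by exact_mod_cast hd
  -- (A) the shift between the two frames
  have hA : (fun X : ℝ => (residueClassPrimeCount X (Real.log X ^ (-c)) d a b : ℝ) -
      classPrimeCount (d * X) (Real.log X ^ (-c)) d a b) =o[atTop] fun X : ℝ => mainTerm c σ₀ X := by
    refine IsBigO.trans_isLittleO ?_
      (isLittleO_linear_mainTerm c hσ₀ (((a : ℝ) + b + 2) * d) ((a : ℝ) + b + 2))
    refine IsBigO.of_bound 1 ?_
    filter_upwards [eventually_ge_atTop (1 : ℝ)] with X hX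
    have hη : 0 ≤ Real.log X ^ (-c) := Real.rpow_nonneg (Real.log_nonneg hX) _
    have h := abs_residueClassPrimeCount_sub_classPrimeCount_le (zero_le_one.trans hX) hη hd a b
    have hpos : 0 ≤ ((a : ℝ) + b + 2) * d * (Real.log X ^ (-c) * X) + ((a : ℝ) + b + 2) := by positivity
    rw [Real.norm_eq_abs, one_mul, Real.norm_of_nonneg hpos]
    calc _ ≤ ((a : ℝ) + b + 2) * (Real.log X ^ (-c) * (d * X) + 1) := h
      _ = ((a : ℝ) + b + 2) * d * (Real.log X ^ (-c) * X) + ((a : ℝ) + b + 2) := by ring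
  -- (B) the band asymptotic at height `dX`
  have hB : (fun X : ℝ => (classPrimeCount (d * X) (Real.log X ^ (-c)) d a b : ℝ) -
      w / (d : ℝ) ^ 2 * (σ₀ * (Real.log X ^ (-c)) ^ 2 * (d * X) ^ 2 / (3 * Real.log (d * X)))) =o[atTop]
      fun X : ℝ => mainTerm c σ₀ X := by
    refine IsBigO.trans_isLittleO ?_ (mainTerm_mul_loglog_isLittleO c σ₀)
    refine IsBigO.of_bound (3 * |C| * (d : ℝ) ^ 2 / σ₀) ?_
    filter_upwards [eventually_ge_atTop (max |X₀| (max (d : ℝ) (Real.exp (Real.exp 1))))] with X hX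
    have hXX₀ : |X₀| ≤ X := le_trans (le_max_left _ _) hX
    have hXd : (d : ℝ) ≤ X := le_trans ((le_max_left _ _).trans (le_max_right _ _)) hX
    have hXe : Real.exp (Real.exp 1) ≤ X := le_trans ((le_max_right _ _).trans (le_max_right _ _)) hX
    have hX1 : 1 < X := by
      have : (1 : ℝ) < Real.exp (Real.exp 1) := Real.one_lt_exp_iff.mpr (Real.exp_pos 1)
      linarith
    have hX0 : 0 < X := by linarith
    set L := Real.log X with hL
    set η := L ^ (-c) with hη
    have hLpos : 0 < L := Real.log_pos hX1
    have hLe : Real.exp 1 ≤ L := by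
      rw [hL, ← Real.log_exp (Real.exp 1)]; exact Real.log_le_log (Real.exp_pos _) hXe
    have hL1 : 1 < L := lt_of_lt_of_le (by have := Real.exp_one_gt_d9; linarith) hLe
    have hLLpos : 0 < Real.log L := Real.log_pos hL1
    have hdX : X ≤ d * X := le_mul_of_one_le_left hX0.le hd1
    have hdX₀ : X₀ ≤ d * X := (le_abs_self X₀).trans (hXX₀.trans hdX)
    have hLd : L ≤ Real.log (d * X) := Real.log_le_log hX0 hdX
    have hLdpos : 0 < Real.log (d * X) := hLpos.trans_le hLd
    have hLd2 : Real.log (d * X) ≤ 2 * L := by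
      rw [Real.log_mul hd0.ne' hX0.ne']
      have : Real.log d ≤ L := Real.log_le_log hd0 hXd
      linarith
    have hη0 : 0 < η := Real.rpow_pos_of_pos hLpos _
    -- the band at height `dX`
    have hlo : Real.log (d * X) ^ (-c) ≤ η := Real.rpow_le_rpow_of_nonpos hLpos hLd (by linarith)
    have hhi : η ≤ Kb * Real.log (d * X) ^ (-c) := by
      have h2 : (2 * L) ^ (-c) ≤ Real.log (d * X) ^ (-c) :=
        Real.rpow_le_rpow_of_nonpos hLdpos hLd2 (by linarith)
      have e : η = Kb * (2 * L) ^ (-c) := by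
        rw [hη, hKb, Real.mul_rpow (by norm_num) hLpos.le, ← mul_assoc, ← Real.rpow_add (by norm_num)]
        simp
      rw [e]
      exact mul_le_mul_of_nonneg_left h2 (by positivity)
    have hmain := hC (d * X) η hdX₀ hlo hhi
    -- compare the scales
    have hM : 0 < mainTerm c σ₀ X := mainTerm_pos hσ₀ hX1
    have hMdef : mainTerm c σ₀ X = σ₀ * η ^ 2 * X ^ 2 / (3 * L) := rfl
    have hscale : η ^ 2 * (d * X) ^ 2 / Real.log (d * X) ≤ 3 * (d : ℝ) ^ 2 / σ₀ * mainTerm c σ₀ X := by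
      rw [hMdef]
      have e : 3 * (d : ℝ) ^ 2 / σ₀ * (σ₀ * η ^ 2 * X ^ 2 / (3 * L)) = η ^ 2 * (d * X) ^ 2 / L := by
        field_simp
      rw [e]
      exact div_le_div_of_nonneg_left (by positivity) hLpos hLd
    have hℓ : Real.log (Real.log (d * X)) ^ (-(1 / 6 : ℝ)) ≤ Real.log L ^ (-(1 / 6 : ℝ)) :=
      Real.rpow_le_rpow_of_nonpos hLLpos (Real.log_le_log hLpos hLd) (by norm_num)
    have hℓ0 : 0 ≤ Real.log (Real.log (d * X)) ^ (-(1 / 6 : ℝ)) :=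
      Real.rpow_nonneg (hLLpos.le.trans (Real.log_le_log hLpos hLd)) _
    have hrhs0 : 0 ≤ η ^ 2 * (d * X) ^ 2 / Real.log (d * X) := by positivity
    rw [Real.norm_eq_abs, Real.norm_of_nonneg (by positivity : (0 : ℝ) ≤ mainTerm c σ₀ X * Real.log L ^ (-(1 / 6 : ℝ)))]
    calc _ ≤ C * (η ^ 2 * (d * X) ^ 2 / Real.log (d * X) * Real.log (Real.log (d * X)) ^ (-(1 / 6 : ℝ))) := hmain
      _ ≤ |C| * (η ^ 2 * (d * X) ^ 2 / Real.log (d * X) * Real.log (Real.log (d * X)) ^ (-(1 / 6 : ℝ))) :=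
          mul_le_mul_of_nonneg_right (le_abs_self C) (by positivity)
      _ ≤ |C| * ((3 * (d : ℝ) ^ 2 / σ₀ * mainTerm c σ₀ X) * Real.log L ^ (-(1 / 6 : ℝ))) := by
          refine mul_le_mul_of_nonneg_left (mul_le_mul hscale hℓ hℓ0 (by positivity)) (abs_nonneg C)
      _ = 3 * |C| * (d : ℝ) ^ 2 / σ₀ * (mainTerm c σ₀ X * Real.log L ^ (-(1 / 6 : ℝ))) := by ring
  -- (C) the main term in the two frames: `(w/d²)σ₀η²(dX)²/(3 log(dX)) − w·M(X) = −w·M(X)·log d/log(dX)`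
  have hCm : (fun X : ℝ => w / (d : ℝ) ^ 2 * (σ₀ * (Real.log X ^ (-c)) ^ 2 * (d * X) ^ 2 /
      (3 * Real.log (d * X))) - w * mainTerm c σ₀ X) =o[atTop] fun X : ℝ => mainTerm c σ₀ X := by
    have hratio : Tendsto (fun X : ℝ => Real.log d / Real.log (d * X)) atTop (𝓝 0) := by
      have h1 : Tendsto (fun X : ℝ => Real.log (d * X)) atTop atTop :=
        Real.tendsto_log_atTop.comp (Tendsto.const_mul_atTop hd0 tendsto_id)
      exact tendsto_const_nhds.div_atTop h1
    have h2 := (isBigO_refl (fun X : ℝ => mainTerm c σ₀ X) atTop).mul_isLittleO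
      ((isLittleO_one_iff ℝ).2 hratio)
    simp only [mul_one] at h2
    refine (h2.const_mul_left (-w)).congr' ?_ EventuallyEq.rfl
    filter_upwards [eventually_gt_atTop (1 : ℝ)] with X hX
    have hX0 : 0 < X := by linarith
    have hL : Real.log X ≠ 0 := (Real.log_pos hX).ne'
    have hdne : (d : ℝ) ≠ 0 := hd0.ne'
    have hLd' : 0 < Real.log (d * X) := Real.log_pos (by nlinarith)
    have hLd : Real.log d + Real.log X ≠ 0 := by rw [← Real.log_mul hdne hX0.ne']; exact hLd'.ne'
    simp only [mainTerm, Real.log_mul hdne hX0.ne']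
    field_simp
    ring
  exact ((hA.add hB).add hCm).congr_left fun X => by ring

/-! ### The crux from the three class lemmas -/

/-- **`HeathBrownMorozUniform` from the class Fundamental-Lemma comparison, the class leading parts and the
class Type II estimate** (the three stubs of the coset port, for every reduced admissible class): compose
`HeathBrownMoroz2004_lemma_3_3` (class Lemma 3.7, tree), `classTypeII_terms_band`, `classSieveComparison_band`,
`classAsymptotic_band`, the frame transfer `classAsymp_allLargeC_of_band` and the finite max
`heathBrownMorozUniform_of_allLargeC`. [cite: HeathBrownMoroz2004, Theorem 2] -/
theorem heathBrownMorozUniform_of_classLemmas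
    (h35 : ∀ d a b : ℕ, 0 < d → a < d → b < d → Nat.Coprime (a ^ 3 + 2 * b ^ 3) d →
      ∀ σ₀ : ℝ, Tendsto singularProductPartial atTop (𝓝 σ₀) → ∀ ϖ : ℝ, 0 < ϖ → ϖ < 1 / 5 →
        ∃ C X₀ : ℝ, ∀ X η : ℝ, X₀ ≤ X → Real.exp (-Real.log X ^ (1 / 3 : ℝ)) ≤ η → η ≤ 1 →
          ∑ n ∈ range (chainBound (hbTau ϖ X) + 1),
              |(Tpiece (classPairs X η d a b) pairIdeal X (hbTau ϖ X) n : ℝ) -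
                  classKappa σ₀ X η d * Tpiece (normWindow X η) (fun J => J) X (hbTau ϖ X) n| ≤
            C * hbTau ϖ X * η ^ 2 * X ^ 2 / Real.log X)
    (h39 : ∀ d a b : ℕ, 0 < d → a < d → b < d → Nat.Coprime (a ^ 3 + 2 * b ^ 3) d →
      ∀ σ₀ : ℝ, Tendsto singularProductPartial atTop (𝓝 σ₀) → ∀ ϖ : ℝ, 0 < ϖ → ϖ < 1 / 5 →
        ∃ c C X₀ : ℝ, ∀ X η : ℝ, X₀ ≤ X → Real.exp (-Real.log X ^ (1 / 3 : ℝ)) ≤ η → η ≤ 1 →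
          ∀ (k : ℕ) (m : Fin k → ℕ), CoreAdmissible (hbTau ϖ X) m →
            ∀ cR : Ideal (𝓞 K) → ℝ, CSupport X (hbTau ϖ X) cR →
              |bilin (classPairs X η d a b) pairIdeal cR (eWeight X (hbTau ϖ X) m) -
                  classKappa σ₀ X η d *
                    bilin (normWindow X η) (fun J => J) cR (dWeight X (hbTau ϖ X) m)| ≤
                C * (∏ i, (m i : ℝ))⁻¹ * η ^ (5 / 2 : ℝ) * X ^ 2 * Real.log X ^ c)
    (h310 : ∀ d a b : ℕ, 0 < d → a < d → b < d → Nat.Coprime (a ^ 3 + 2 * b ^ 3) d →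
      ∀ ϖ : ℝ, 0 < ϖ → ϖ < 1 / 5 →
        ∃ c c₃ c₄ : ℝ, 0 < c₃ ∧ 0 < c₄ ∧ ∀ C₁ c₁ c₅ c₆ : ℝ, 0 < c₁ → 0 < c₅ → 0 < c₆ →
          ∃ C X₀ : ℝ, ∀ X η Q₁ : ℝ, X₀ ≤ X → Real.exp (-Real.log X ^ (1 / 3 : ℝ)) ≤ η → η ≤ 1 →
            1 ≤ Q₁ → (d : ℝ) * Q₁ ≤ Real.exp (Real.log X ^ (1 / 3 : ℝ)) →
              (∀ (k' : ℕ) (m' : Fin k' → ℕ), CoreAdmissible (hbTau ϖ X) m' →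
                Hyp314 X (hbTau ϖ X) m' ((d : ℝ) * Q₁) C₁ c₁ c₃ c₄) →
                ∀ (k : ℕ) (m : Fin k → ℕ), CoreAdmissible (hbTau ϖ X) m →
                  ∀ cR : Ideal (𝓞 K) → ℝ, CSupport X (hbTau ϖ X) cR →
                    ∀ V : ℝ, c₅ * X ^ (1 + hbTau ϖ X) ≤ V → V ≤ c₆ * X ^ (3 / 2 - hbTau ϖ X) →
                      |bilin (classPairs X η d a b) pairIdeal cR
                          (fun S => if V < (Ideal.absNorm S : ℝ) ∧ (Ideal.absNorm S : ℝ) ≤ 2 * V then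
                            fWeight X (hbTau ϖ X) m S else 0)| ≤
                        C * X ^ 2 * Q₁ ^ (-(1 / 160 : ℝ)) * Real.log X ^ c) :
    Summit.Parity.GeneralizedHardyLittlewood.Theses.GoldbachHeathBrownDispersion.HeathBrownMorozUniform := by
  refine heathBrownMorozUniform_of_allLargeC fun d a b hd ha hb hadm => ?_
  have hd1 : 1 ≤ d := hd
  have h37A : ∀ ϖ : ℝ, 0 < ϖ → ϖ < 1 / 5 →
      ∃ C X₀ : ℝ, ∀ X η : ℝ, X₀ ≤ X → Real.exp (-Real.log X ^ (1 / 3 : ℝ)) ≤ η → η ≤ 1 →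
        (∑ n ∈ Icc 3 (chainBound (hbTau ϖ X)),
            |(Upiece (classPairs X η d a b) pairIdeal X (hbTau ϖ X) n : ℝ) -
              Uhat X (hbTau ϖ X) (classPairs X η d a b) pairIdeal n| ≤
          C * (hbXi (hbTau ϖ X) / hbTau ϖ X ^ 4) * (η ^ 2 * X ^ 2 / Real.log X)) ∧
        (|(U1piece (classPairs X η d a b) pairIdeal X (hbTau ϖ X) 1 : ℝ) -
            Uhat X (hbTau ϖ X) (classPairs X η d a b) pairIdeal 1| ≤
          C * (hbXi (hbTau ϖ X) / hbTau ϖ X ^ 4) * (η ^ 2 * X ^ 2 / Real.log X)) ∧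
        (|(U1piece (classPairs X η d a b) pairIdeal X (hbTau ϖ X) 2 : ℝ) -
            Uhat X (hbTau ϖ X) (classPairs X η d a b) pairIdeal 2| ≤
          C * (hbXi (hbTau ϖ X) / hbTau ϖ X ^ 4) * (η ^ 2 * X ^ 2 / Real.log X)) ∧
        (|(S₄ (classPairs X η d a b) pairIdeal X (hbTau ϖ X) : ℝ) -
            S4hat X (hbTau ϖ X) (classPairs X η d a b) pairIdeal| ≤
          C * (hbXi (hbTau ϖ X) / hbTau ϖ X ^ 4) * (η ^ 2 * X ^ 2 / Real.log X)) ∧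
        (|(U2one (classPairs X η d a b) pairIdeal X (hbTau ϖ X) : ℝ) -
            U2hat X (hbTau ϖ X) (classPairs X η d a b) pairIdeal| ≤
          C * (hbXi (hbTau ϖ X) / hbTau ϖ X ^ 4) * (η ^ 2 * X ^ 2 / Real.log X)) := by
    intro ϖ h0 h1
    obtain ⟨C, X₀, h⟩ := HeathBrownMoroz2004_lemma_3_3 ϖ h0 h1
    exact ⟨C, X₀, fun X η hX hη hη1 => h X η hX hη hη1 _ (classPairs_subset_boxPairs X η d a b)⟩
  have hII := classTypeII_terms_band d a b hd1 h37A (h39 d a b hd ha hb hadm) (h310 d a b hd ha hb hadm)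
  have hcmp := classSieveComparison_band d a b hd1 (h35 d a b hd ha hb hadm) hII
  exact classAsymp_allLargeC_of_band hd1 (classAsymptotic_band d a b hd1 hcmp)

end Summit.Parity.GeneralizedHardyLittlewood.Theorems.GoldbachHeathBrownDispersionHeathBrownMorozUniform

end
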